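import Summits.RiemannHypothesis.RiemannHypothesis.Theorems.SignConeConeMagnificationTrivialDesignHarnack
import Summits.RiemannHypothesis.RiemannHypothesis.Theorems.SignConeConeMagnificationStubFakePNT
import Summits.RiemannHypothesis.RiemannHypothesis.Theorems.SignConeConeMagnificationStubChebyshev
import Summits.RiemannHypothesis.RiemannHypothesis.Theorems.SignConeConeMagnificationStubContinuation
import Summits.RiemannHypothesis.RiemannHypothesis.Theorems.SignConeConeMagnificationStubPdLaplace
import Summits.RiemannHypothesis.RiemannHypothesis.Theorems.SignConeConeMagnificationStubCara

/-!
# Crux `SignCone.ConeMagnification` (stmt-RiemannHypothesis-16303), line `Sketch` r8: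
# the trivial type inequality with room for UNIT-SLACK weights

`F`-free corollary of `…TrivialDesignHarnack` through the landed stubs of the line (`stub_fakePNT` p130740,
`stub_chebyshev` p131015, `stub_continuation` p130893, `stub_pdLaplace` p132066, `stub_cara` p133591): for every
weight `c ≥ 0`, `c 1 = 0`, with unit slack against every Weil test,
`limsup_{σ → 1+} (L_c(σ) − 1/(σ−1)) + γ ≤ 49/100`, stated with explicit `ε`/`δ`
(`trivialDesign_of_unitSlack`, anchor `trivialDesignOfUnitSlack`).  With Mertens for `c` (`stub_fakeMertens`) the
left side is the 2001 trivial-design constant `C₁ = lim_x Σ_{n ≤ x} (c(n) − Λ(n))/n`, so `C₁ ≤ 0.49 < 1/2`.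
-/

noncomputable section

-- `Summit.RiemannHypothesis.RiemannHypothesis.…` repeats a namespace component by design (D-0017 layout).
set_option linter.dupNamespace false

open scoped BigOperators Topology
open Complex Set Filter Metric

namespace Summit.RiemannHypothesis.RiemannHypothesis.Theorems.SignConeConeMagnification

open Literature.NumberTheory.LFunctions
open Summit.RiemannHypothesis.RiemannHypothesis.Theorems.SignCone
open Summit.RiemannHypothesis.RiemannHypothesis.Cruxes.ConeMagnification.Sketch (stub_continuation)

/-- **The trivial type inequality with room, for unit-slack weights.**  If `c ≥ 0`, `c 1 = 0` has unit slack against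
every Weil test, then for every `ε > 0` there is `δ > 0` with
`Re L_c(σ) − 1/(σ−1) + γ ≤ 49/100 + ε` for all `1 < σ < 1 + δ` (the landed chain fakePNT → chebyshev → continuation,
pdLaplace → cara produces a Carathéodory description `F`, `…TrivialDesignHarnack` bounds `Re F(1) + γ`, and `F` is
continuous at `1`). [folklore] -/
theorem trivialDesign_of_unitSlack (c : ℕ → ℝ) (hc0 : ∀ n, 0 ≤ c n) (hc1 : c 1 = 0)
    (hU : ∀ g : ℝ → ℂ, IsWeilTest g →
      -(∫ t, ‖g t‖ ^ 2) ≤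
        (weilPolarTerm (weilConv g (weilReflect g)) + weilArchTerm (weilConv g (weilReflect g)) -
          ∑' n : ℕ, ((c n : ℝ) : ℂ) / (Real.sqrt n : ℂ) *
            (weilConv g (weilReflect g) (Real.log n) + weilConv g (weilReflect g) (-Real.log n))).re) :
    ∀ ε : ℝ, 0 < ε → ∃ δ : ℝ, 0 < δ ∧ ∀ σ : ℝ, 1 < σ → σ < 1 + δ →
      (LSeries (fun n => ((c n : ℝ) : ℂ)) σ).re - 1 / (σ - 1) + Real.eulerMascheroniConstant ≤ 49 / 100 + ε := by
  have hPNT := stub_fakePNT c hc0 hU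
  have hsum := stub_chebyshev c hc0 hPNT
  have hcont := stub_continuation c hc0 hPNT hsum
  have hPD := stub_pdLaplace c hc0 hU
  obtain ⟨F, hFd, hFeq, hFle⟩ := stub_cara c hc0 hc1 hU hsum hcont hPD
  have hmain := TrivialDesign.re_apply_one_add_euler_le c hc0 hc1 hsum F hFd hFeq hFle
  intro ε hε
  have hopen : IsOpen {s : ℂ | 1 / 2 < s.re} := isOpen_lt continuous_const Complex.continuous_re
  have h1 : (1 : ℂ) ∈ {s : ℂ | 1 / 2 < s.re} := by
    simp only [Set.mem_setOf_eq, Complex.one_re]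
    norm_num
  have hcontF : ContinuousAt F 1 := (hFd.differentiableAt (hopen.mem_nhds h1)).continuousAt
  obtain ⟨δ, hδ, hδF⟩ := Metric.continuousAt_iff.1 hcontF ε hε
  refine ⟨δ, hδ, fun σ hσ1 hσδ => ?_⟩
  have hdist : dist (σ : ℂ) 1 < δ := by
    rw [dist_eq_norm, show (σ : ℂ) - 1 = ((σ - 1 : ℝ) : ℂ) by push_cast; ring, Complex.norm_real,
      Real.norm_eq_abs, abs_of_pos (by linarith)]
    linarith
  have h := hδF hdist
  rw [dist_eq_norm] at h
  have hre : (F (σ : ℂ)).re - (F 1).re ≤ ‖F (σ : ℂ) - F 1‖ := by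
    rw [← Complex.sub_re]
    exact Complex.re_le_norm _
  have hFσ : F (σ : ℂ) = LSeries (fun n => ((c n : ℝ) : ℂ)) σ - 1 / ((σ : ℂ) - 1) :=
    hFeq σ (by simpa using hσ1)
  have hreσ : (F (σ : ℂ)).re = (LSeries (fun n => ((c n : ℝ) : ℂ)) σ).re - 1 / (σ - 1) := by
    rw [hFσ, Complex.sub_re]
    congr 1
    rw [show (σ : ℂ) - 1 = ((σ - 1 : ℝ) : ℂ) by push_cast; ring, ← Complex.ofReal_one, ← Complex.ofReal_div,
      Complex.ofReal_re]
  rw [hreσ] at hre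
  linarith

/-- **Anchor `trivialDesignOfUnitSlack`** (registered sub-goal): the trivial type inequality with room for unit-slack
weights, `limsup_{σ→1+} (Re L_c(σ) − 1/(σ−1)) + γ ≤ 49/100`, in `ε`/`δ` form. [folklore] -/
theorem trivialDesignOfUnitSlack : ∀ c : ℕ → ℝ, (∀ n, 0 ≤ c n) → c 1 = 0 →
    (∀ g : ℝ → ℂ, IsWeilTest g →
      -(∫ t, ‖g t‖ ^ 2) ≤
        (weilPolarTerm (weilConv g (weilReflect g)) + weilArchTerm (weilConv g (weilReflect g)) -
          ∑' n : ℕ, ((c n : ℝ) : ℂ) / (Real.sqrt n : ℂ) *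
            (weilConv g (weilReflect g) (Real.log n) + weilConv g (weilReflect g) (-Real.log n))).re) →
    ∀ ε : ℝ, 0 < ε → ∃ δ : ℝ, 0 < δ ∧ ∀ σ : ℝ, 1 < σ → σ < 1 + δ →
      (LSeries (fun n => ((c n : ℝ) : ℂ)) σ).re - 1 / (σ - 1) + Real.eulerMascheroniConstant ≤ 49 / 100 + ε :=
  fun c hc0 hc1 hU => trivialDesign_of_unitSlack c hc0 hc1 hU

end Summit.RiemannHypothesis.RiemannHypothesis.Theorems.SignConeConeMagnification

end
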